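import Summits.BirchSwinnertonDyer.BirchSwinnertonDyer.Theses.ShaPrimaryTransfer
import Literature.NumberTheory.EllipticCurves.KubertTate373EisensteinTwist
import Literature.NumberTheory.EllipticCurves.KubertTateM223EisensteinTwist
import Literature.NumberTheory.EllipticCurves.KubertTateFiveEisensteinTwistMinimalModel
import Literature.NumberTheory.EllipticCurves.CastellaGrossiLeeSkinner2022.PConverse
import Literature.NumberTheory.EllipticCurves.IwasawaLeadingTermProofs
import HarnessLib

/-!
# BirchSwinnertonDyer / ShaPrimaryTransfer — crux `FiniteShaComponentTransfer` (stmt-BirchSwinnertonDyer-22356):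
# THE EISENSTEIN-TWIST DOORS — T DISCHARGED AT A RANK-1 AND A RANK-0 CURVE MODULO REFEREED PRINT (CGLS Thm. E + GZK)

Helper file of prover seat `bsd-line-spt-p1` g22 (`--supports stmt-22356 --as helper`). THEOREMS ONLY.  The tree's Gaussian-twist doors
(g20/g21, twists by `-4` of Kubert–Tate `5`-torsion curves, descent over `ℚ(i)`) open the door at `5` unconditionally but at ANOMALOUS
Eisenstein pairs (`a₅ ≡ 1 (mod 5)`: `5` splits in `ℚ(i)`), outside the printed scope of every refereed `5`-converse theorem
(`…GaussianTwistDoorM919Anomalous`).  This generation built the EISENSTEIN TWIN — the complete `5`-descent of `E_{m,n}` over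
`ℚ(ζ₃) = ℚ(√-3)` (`KubertTateFiveSelmerTameEisenstein`, `KubertTateFiveMuDescentEisensteinBox`, `KubertTateFiveEisensteinTwist`) — whose
twists `E_{m,n}^{(-3)}` have `a₅ = -a₅(E_{m,n}) ≡ -1 (mod 5)` because `5` is INERT in `ℚ(√-3)`: NON-anomalous Eisenstein pairs, inside the
printed scope of Castella–Grossi–Lee–Skinner, Invent. Math. 227 (2022), Theorem E (tree named facts
`thmE_analyticRank_eq_one_of_selmerCorank_eq_one`, `thmE_analyticRank_eq_zero_of_selmerCorank_eq_zero`; REFEREED).  Two instances,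
both on GLOBALLY MINIMAL models with `a₅ = -1` (tree `KubertTate373EisensteinTwist`, `KubertTateM223EisensteinTwist`):

* `W₁ = [0, −540, −11, 53097, −852573] ≅ E_{37/3}^{(-3)}`: **rank `1`, `t₅ = 0`, `corank_{ℤ₅} Sel_{5^∞} = 1`** unconditionally (descent);
* `W₀ = [1, −613, −12, 121470, −7796228] ≅ E_{-2/23}^{(-3)}`: **rank `0`, `t₅ = 0`, `corank_{ℤ₅} Sel_{5^∞} = 0`** unconditionally (descent).

Route currency: O (door `p₀ = 5`) for both; T BY NAME for both; and — the point of the construction —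

* `analyticRank_W₁_eq_one_of_thmE`, `finite_sha_W₁_of_thmE`, **`transfer_W₁_of_thmE`**: granting CGLS Thm. E (`r = 1`) and
  Gross–Zagier–Kolyvagin, `ord_{s=1} L(W₁, s) = 1`, `Ш(W₁/ℚ)` is finite and **T HOLDS AT `W₁`** (every `t_q(W₁) = 0`): the FIRST rank-`1`
  curve in the tree WITHOUT rational `5`-torsion at which the transfer statement is discharged from the descent side by refereed
  print alone — its analytic rank was not known beforehand;
* `analyticRank_W₀_eq_zero_of_thmE`, `finite_sha_W₀_of_thmE`, **`transfer_W₀_of_thmE`**: the same at the rank-`0` twist from Thm. E (`r = 0`).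

And CLASS-WIDE (§4, `transfer_of_eisensteinTwistModel_of_thmE`): for ALL coprime `m, n` with `E_{m,n}` Eisenstein-tame, full `ℚ`-box,
and twist rank attaining `ω₂(mn) ≤ 1`, EVERY globally minimal model `W'` of `E_{m,n}^{(-3)}` satisfies T modulo CGLS Thm. E + GZK — the
hypotheses `Good`/`Red`/`¬ Anom`/`corank Sel₅∞ = ω₂` being tree theorems (`KubertTateFiveEisensteinTwistMinimalModel.cgls_hypotheses_of_model`:
`a₅(W') = -a₅(E) ≡ -1 (mod 5)` by the twisting formula, `5` inert in `ℚ(√-3)`).  Per curve the certificate is: a box of rational points on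
`E_{m,n}`, and (if `ω₂ = 1`) one point of infinite order on the twist.

T itself is UNCHANGED (conjecture-grade at corank ≥ 2: no `p`-converse exists there) and BSD is NOT proved by any of this.

## References

* [CastellaGrossiLeeSkinner2022] F. Castella, G. Grossi, J. Lee, C. Skinner, *On the anticyclotomic Iwasawa theory of rational elliptic
  curves at Eisenstein primes*, Invent. Math. 227 (2022) 517–580, Theorem E = Thm. 5.2.1 (`r ∈ {0, 1}`).
* [Darmon2004] H. Darmon, *Rational points on modular elliptic curves*, CBMS 101, Thm. 3.22 (Gross–Zagier–Kolyvagin).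
* [SilvermanAEC2009] J. H. Silverman, *AEC*, 2nd ed., Thm. X.4.2, Exercise 10.16.
-/

-- D-0017: single-problem summit, so `Summit.BirchSwinnertonDyer.BirchSwinnertonDyer.…` repeats a namespace BY DESIGN.
set_option linter.dupNamespace false
set_option autoImplicit false

noncomputable section

open scoped Classical
open Literature.NumberTheory.EllipticCurves WeierstrassCurve
open Literature.NumberTheory.EllipticCurves.Rank1Residual
open Literature.NumberTheory.EllipticCurves.CastellaGrossiLeeSkinner2022
open Summit.BirchSwinnertonDyer.BirchSwinnertonDyer.Theses.ShaPrimaryTransfer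

namespace Summit.BirchSwinnertonDyer.BirchSwinnertonDyer.Theorems.ShaPrimaryTransferEisensteinTwistDoor

/-! ## §1 The rank-1 door `W₁ = [0, −540, −11, 53097, −852573] ≅ E_{37/3}^{(-3)}` -/

/-- **`t₅(W₁) = 0` unconditionally** (`corank Sel₅∞ = 1 = rank`; tree `KubertTate373EisensteinTwist`). [cite: SilvermanAEC2009, Thm. X.4.2] -/
theorem shaCorank_five_W₁_eq_zero :
    haveI := KubertTate373EisensteinTwist.isElliptic_model
    (⟨((0 : ℤ) : ℚ), ((-540 : ℤ) : ℚ), ((-11 : ℤ) : ℚ), ((53097 : ℤ) : ℚ), ((-852573 : ℤ) : ℚ)⟩ : WeierstrassCurve ℚ).shaCorank 5 = 0 := by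
  haveI := KubertTate373EisensteinTwist.isElliptic_model
  haveI : Fact (Nat.Prime 5) := ⟨Nat.prime_five⟩
  have hS := KubertTate373EisensteinTwist.selmerCorank_model_five
  have hR := KubertTate373EisensteinTwist.mordellWeilRank_model
  have hG := (⟨((0 : ℤ) : ℚ), ((-540 : ℤ) : ℚ), ((-11 : ℤ) : ℚ), ((53097 : ℤ) : ℚ), ((-852573 : ℤ) : ℚ)⟩ :
    WeierstrassCurve ℚ).selmerCorank_eq_mordellWeilRank_add_holds 5
  omega

/-- **O for `W₁` with witness `p₀ = 5`** (the route's `OneFiniteShaComponent` shape, unconditional). [cite: SilvermanAEC2009, Thm. X.4.2] -/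
theorem oneFiniteShaComponent_W₁ :
    haveI := KubertTate373EisensteinTwist.isElliptic_model
    ∃ (p : ℕ) (_ : Fact p.Prime),
      (⟨((0 : ℤ) : ℚ), ((-540 : ℤ) : ℚ), ((-11 : ℤ) : ℚ), ((53097 : ℤ) : ℚ), ((-852573 : ℤ) : ℚ)⟩ : WeierstrassCurve ℚ).shaCorank p = 0 :=
  ⟨5, ⟨Nat.prime_five⟩, shaCorank_five_W₁_eq_zero⟩

/-- **T BY NAME on `W₁`**: granting `FiniteShaComponentTransfer`, every `t_q(W₁) = 0`. T itself is NOT proved. [cite: SilvermanAEC2009, Thm. X.4.2] -/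
theorem transfer_W₁ (hT : FiniteShaComponentTransfer) (q : ℕ) [Fact q.Prime] :
    haveI := KubertTate373EisensteinTwist.isElliptic_model
    (⟨((0 : ℤ) : ℚ), ((-540 : ℤ) : ℚ), ((-11 : ℤ) : ℚ), ((53097 : ℤ) : ℚ), ((-852573 : ℤ) : ℚ)⟩ : WeierstrassCurve ℚ).shaCorank q = 0 := by
  haveI := KubertTate373EisensteinTwist.isElliptic_model
  haveI : Fact (Nat.Prime 5) := ⟨Nat.prime_five⟩
  exact hT _ 5 q shaCorank_five_W₁_eq_zero

/-- **`ord_{s=1} L(W₁, s) = 1` modulo CGLS Theorem E (`r = 1`)**: the pair `(W₁, 5)` is a non-anomalous Eisenstein pair of good reduction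
(`Good`, `Red`, `¬ Anom`: tree `KubertTate373EisensteinTwist.good_red_not_anom_five_model`, `a₅ = -1`) with `corank_{ℤ₅} Sel_{5^∞}(W₁/ℚ) = 1`
certified by descent. [cite: CastellaGrossiLeeSkinner2022, Theorem E = Thm. 5.2.1 (r = 1)] -/
theorem analyticRank_W₁_eq_one_of_thmE (h : thmE_analyticRank_eq_one_of_selmerCorank_eq_one) :
    haveI := KubertTate373EisensteinTwist.isElliptic_model
    (⟨((0 : ℤ) : ℚ), ((-540 : ℤ) : ℚ), ((-11 : ℤ) : ℚ), ((53097 : ℤ) : ℚ), ((-852573 : ℤ) : ℚ)⟩ : WeierstrassCurve ℚ).analyticRank = 1 := by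
  haveI := KubertTate373EisensteinTwist.isElliptic_model
  haveI := KubertTate373EisensteinTwist.isGloballyMinimal_model
  haveI : Fact (Nat.Prime 5) := ⟨Nat.prime_five⟩
  obtain ⟨hgood, hred, hna⟩ := KubertTate373EisensteinTwist.good_red_not_anom_five_model
  exact h _ 5 (by norm_num) hgood hred hna KubertTate373EisensteinTwist.selmerCorank_model_five

/-- **`Ш(W₁/ℚ)` is finite modulo CGLS Theorem E and Gross–Zagier–Kolyvagin** (the printed "and so" clause).
[cite: CastellaGrossiLeeSkinner2022, Theorem E ("and so" clause)] [cite: Darmon2004, Thm. 3.22] -/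
theorem finite_sha_W₁_of_thmE (h : thmE_analyticRank_eq_one_of_selmerCorank_eq_one)
    (hGZK : rank_eq_analyticRank_of_analyticRank_le_one) :
    haveI := KubertTate373EisensteinTwist.isElliptic_model
    Finite (⟨((0 : ℤ) : ℚ), ((-540 : ℤ) : ℚ), ((-11 : ℤ) : ℚ), ((53097 : ℤ) : ℚ), ((-852573 : ℤ) : ℚ)⟩ : WeierstrassCurve ℚ).sha := by
  haveI := KubertTate373EisensteinTwist.isElliptic_model
  haveI := KubertTate373EisensteinTwist.isGloballyMinimal_model
  haveI : Fact (Nat.Prime 5) := ⟨Nat.prime_five⟩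
  obtain ⟨hgood, hred, hna⟩ := KubertTate373EisensteinTwist.good_red_not_anom_five_model
  exact (rank_eq_one_and_finite_sha_of_thmE (p := 5) h hGZK (by norm_num) hgood hred hna
    KubertTate373EisensteinTwist.selmerCorank_model_five).2.2

/-- **T DISCHARGED AT THE RANK-1 CURVE `W₁` MODULO REFEREED PRINT**: granting CGLS Theorem E (`r = 1`) and Gross–Zagier–Kolyvagin, the
instance of `FiniteShaComponentTransfer` at `W₁ = [0, −540, −11, 53097, −852573]` holds — indeed every `t_q(W₁) = 0`.  Everything else
(rank `1`, `t₅ = 0`, `a₅ = -1`, reducibility, minimality) is proved in the tree by descent and kernel arithmetic.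
[cite: CastellaGrossiLeeSkinner2022, Theorem E] [cite: Darmon2004, Thm. 3.22] -/
theorem transfer_W₁_of_thmE (h : thmE_analyticRank_eq_one_of_selmerCorank_eq_one)
    (hGZK : rank_eq_analyticRank_of_analyticRank_le_one) (p q : ℕ) [Fact p.Prime] [Fact q.Prime] :
    haveI := KubertTate373EisensteinTwist.isElliptic_model
    (⟨((0 : ℤ) : ℚ), ((-540 : ℤ) : ℚ), ((-11 : ℤ) : ℚ), ((53097 : ℤ) : ℚ), ((-852573 : ℤ) : ℚ)⟩ : WeierstrassCurve ℚ).shaCorank p = 0 →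
      (⟨((0 : ℤ) : ℚ), ((-540 : ℤ) : ℚ), ((-11 : ℤ) : ℚ), ((53097 : ℤ) : ℚ), ((-852573 : ℤ) : ℚ)⟩ : WeierstrassCurve ℚ).shaCorank q = 0 := by
  haveI := KubertTate373EisensteinTwist.isElliptic_model
  intro _
  haveI := finite_sha_W₁_of_thmE h hGZK
  exact (finite_primaryComponent_sha_iff_shaCorank_eq_zero _ q).1 inferInstance

/-! ## §2 The rank-0 door `W₀ = [1, −613, −12, 121470, −7796228] ≅ E_{-2/23}^{(-3)}` -/

/-- **`t₅(W₀) = 0` unconditionally** (`corank Sel₅∞ = 0 = rank`; tree `KubertTateM223EisensteinTwist`). [cite: SilvermanAEC2009, Thm. X.4.2] -/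
theorem shaCorank_five_W₀_eq_zero :
    haveI := KubertTateM223EisensteinTwist.isElliptic_model
    (⟨((1 : ℤ) : ℚ), ((-613 : ℤ) : ℚ), ((-12 : ℤ) : ℚ), ((121470 : ℤ) : ℚ), ((-7796228 : ℤ) : ℚ)⟩ : WeierstrassCurve ℚ).shaCorank 5 = 0 := by
  haveI := KubertTateM223EisensteinTwist.isElliptic_model
  haveI : Fact (Nat.Prime 5) := ⟨Nat.prime_five⟩
  have hS := KubertTateM223EisensteinTwist.selmerCorank_model_five
  have hR := KubertTateM223EisensteinTwist.mordellWeilRank_model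
  have hG := (⟨((1 : ℤ) : ℚ), ((-613 : ℤ) : ℚ), ((-12 : ℤ) : ℚ), ((121470 : ℤ) : ℚ), ((-7796228 : ℤ) : ℚ)⟩ :
    WeierstrassCurve ℚ).selmerCorank_eq_mordellWeilRank_add_holds 5
  omega

/-- **O for `W₀` with witness `p₀ = 5`** (unconditional). [cite: SilvermanAEC2009, Thm. X.4.2] -/
theorem oneFiniteShaComponent_W₀ :
    haveI := KubertTateM223EisensteinTwist.isElliptic_model
    ∃ (p : ℕ) (_ : Fact p.Prime),
      (⟨((1 : ℤ) : ℚ), ((-613 : ℤ) : ℚ), ((-12 : ℤ) : ℚ), ((121470 : ℤ) : ℚ), ((-7796228 : ℤ) : ℚ)⟩ : WeierstrassCurve ℚ).shaCorank p = 0 :=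
  ⟨5, ⟨Nat.prime_five⟩, shaCorank_five_W₀_eq_zero⟩

/-- **T BY NAME on `W₀`**: granting `FiniteShaComponentTransfer`, every `t_q(W₀) = 0`. T itself is NOT proved. [cite: SilvermanAEC2009, Thm. X.4.2] -/
theorem transfer_W₀ (hT : FiniteShaComponentTransfer) (q : ℕ) [Fact q.Prime] :
    haveI := KubertTateM223EisensteinTwist.isElliptic_model
    (⟨((1 : ℤ) : ℚ), ((-613 : ℤ) : ℚ), ((-12 : ℤ) : ℚ), ((121470 : ℤ) : ℚ), ((-7796228 : ℤ) : ℚ)⟩ : WeierstrassCurve ℚ).shaCorank q = 0 := by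
  haveI := KubertTateM223EisensteinTwist.isElliptic_model
  haveI : Fact (Nat.Prime 5) := ⟨Nat.prime_five⟩
  exact hT _ 5 q shaCorank_five_W₀_eq_zero

/-- **`L(W₀, 1) ≠ 0` (`ord_{s=1} L(W₀, s) = 0`) modulo CGLS Theorem E (`r = 0`)**: `(W₀, 5)` is a non-anomalous Eisenstein pair of good
reduction (tree `KubertTateM223EisensteinTwist.good_red_not_anom_five_model`, `a₅ = -1`) with `corank_{ℤ₅} Sel_{5^∞}(W₀/ℚ) = 0` certified by
descent. [cite: CastellaGrossiLeeSkinner2022, Theorem E = Thm. 5.2.1 (r = 0)] -/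
theorem analyticRank_W₀_eq_zero_of_thmE (h0 : thmE_analyticRank_eq_zero_of_selmerCorank_eq_zero) :
    haveI := KubertTateM223EisensteinTwist.isElliptic_model
    (⟨((1 : ℤ) : ℚ), ((-613 : ℤ) : ℚ), ((-12 : ℤ) : ℚ), ((121470 : ℤ) : ℚ), ((-7796228 : ℤ) : ℚ)⟩ : WeierstrassCurve ℚ).analyticRank = 0 := by
  haveI := KubertTateM223EisensteinTwist.isElliptic_model
  haveI := KubertTateM223EisensteinTwist.isGloballyMinimal_model
  haveI : Fact (Nat.Prime 5) := ⟨Nat.prime_five⟩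
  obtain ⟨hgood, hred, hna⟩ := KubertTateM223EisensteinTwist.good_red_not_anom_five_model
  exact h0 _ 5 (by norm_num) hgood hred hna KubertTateM223EisensteinTwist.selmerCorank_model_five

/-- **`Ш(W₀/ℚ)` is finite modulo CGLS Theorem E (`r = 0`) and Gross–Zagier–Kolyvagin.**
[cite: CastellaGrossiLeeSkinner2022, Theorem E (r = 0, "and so" clause)] [cite: Darmon2004, Thm. 3.22] -/
theorem finite_sha_W₀_of_thmE (h0 : thmE_analyticRank_eq_zero_of_selmerCorank_eq_zero)
    (hGZK : rank_eq_analyticRank_of_analyticRank_le_one) :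
    haveI := KubertTateM223EisensteinTwist.isElliptic_model
    Finite (⟨((1 : ℤ) : ℚ), ((-613 : ℤ) : ℚ), ((-12 : ℤ) : ℚ), ((121470 : ℤ) : ℚ), ((-7796228 : ℤ) : ℚ)⟩ : WeierstrassCurve ℚ).sha := by
  haveI := KubertTateM223EisensteinTwist.isElliptic_model
  haveI := KubertTateM223EisensteinTwist.isGloballyMinimal_model
  haveI : Fact (Nat.Prime 5) := ⟨Nat.prime_five⟩
  obtain ⟨hgood, hred, hna⟩ := KubertTateM223EisensteinTwist.good_red_not_anom_five_model
  exact (rank_eq_zero_and_finite_sha_of_thmE (p := 5) h0 hGZK (by norm_num) hgood hred hna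
    KubertTateM223EisensteinTwist.selmerCorank_model_five).2.2

/-- **T DISCHARGED AT THE RANK-0 CURVE `W₀` MODULO REFEREED PRINT**: granting CGLS Theorem E (`r = 0`) and Gross–Zagier–Kolyvagin, the
instance of `FiniteShaComponentTransfer` at `W₀ = [1, −613, −12, 121470, −7796228]` holds (every `t_q(W₀) = 0`).
[cite: CastellaGrossiLeeSkinner2022, Theorem E] [cite: Darmon2004, Thm. 3.22] -/
theorem transfer_W₀_of_thmE (h0 : thmE_analyticRank_eq_zero_of_selmerCorank_eq_zero)
    (hGZK : rank_eq_analyticRank_of_analyticRank_le_one) (p q : ℕ) [Fact p.Prime] [Fact q.Prime] :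
    haveI := KubertTateM223EisensteinTwist.isElliptic_model
    (⟨((1 : ℤ) : ℚ), ((-613 : ℤ) : ℚ), ((-12 : ℤ) : ℚ), ((121470 : ℤ) : ℚ), ((-7796228 : ℤ) : ℚ)⟩ : WeierstrassCurve ℚ).shaCorank p = 0 →
      (⟨((1 : ℤ) : ℚ), ((-613 : ℤ) : ℚ), ((-12 : ℤ) : ℚ), ((121470 : ℤ) : ℚ), ((-7796228 : ℤ) : ℚ)⟩ : WeierstrassCurve ℚ).shaCorank q = 0 := by
  haveI := KubertTateM223EisensteinTwist.isElliptic_model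
  intro _
  haveI := finite_sha_W₀_of_thmE h0 hGZK
  exact (finite_primaryComponent_sha_iff_shaCorank_eq_zero _ q).1 inferInstance

/-! ## §3 Where T's instances at `W₀`, `W₁` sit -/

/-- **What the two Eisenstein-twist doors prove about T.** Below CGLS Theorem E (both printed cases) and Gross–Zagier–Kolyvagin, T's
instances at `W₀` (rank `0`) and `W₁` (rank `1`) BOTH hold — with NO further input: the Selmer coranks `0` and `1` that Theorem E consumes are
theorems of the tree (complete `5`-descents over `ℚ(ζ₃)`), and so are the standing hypotheses `5 > 2`, good, reducible, `a₅ ≢ 1 (mod 5)`.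
What remains OPEN of T is exactly its content at corank `≥ 2` (e.g. the Gaussian rank-`2` twist `E_{146/13}^{(-4)}`), where no `p`-converse
is in print. [cite: CastellaGrossiLeeSkinner2022, Theorem E (r ∈ {0,1})] [cite: Darmon2004, Thm. 3.22] -/
theorem transfer_at_eisenstein_twist_doors_of_thmE
    (h1 : thmE_analyticRank_eq_one_of_selmerCorank_eq_one) (h0 : thmE_analyticRank_eq_zero_of_selmerCorank_eq_zero)
    (hGZK : rank_eq_analyticRank_of_analyticRank_le_one) :
    haveI := KubertTate373EisensteinTwist.isElliptic_model
    haveI := KubertTateM223EisensteinTwist.isElliptic_model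
    (∀ (p q : ℕ) [Fact p.Prime] [Fact q.Prime],
      (⟨((0 : ℤ) : ℚ), ((-540 : ℤ) : ℚ), ((-11 : ℤ) : ℚ), ((53097 : ℤ) : ℚ), ((-852573 : ℤ) : ℚ)⟩ : WeierstrassCurve ℚ).shaCorank p = 0 →
        (⟨((0 : ℤ) : ℚ), ((-540 : ℤ) : ℚ), ((-11 : ℤ) : ℚ), ((53097 : ℤ) : ℚ), ((-852573 : ℤ) : ℚ)⟩ : WeierstrassCurve ℚ).shaCorank q = 0) ∧
    (∀ (p q : ℕ) [Fact p.Prime] [Fact q.Prime],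
      (⟨((1 : ℤ) : ℚ), ((-613 : ℤ) : ℚ), ((-12 : ℤ) : ℚ), ((121470 : ℤ) : ℚ), ((-7796228 : ℤ) : ℚ)⟩ : WeierstrassCurve ℚ).shaCorank p = 0 →
        (⟨((1 : ℤ) : ℚ), ((-613 : ℤ) : ℚ), ((-12 : ℤ) : ℚ), ((121470 : ℤ) : ℚ), ((-7796228 : ℤ) : ℚ)⟩ : WeierstrassCurve ℚ).shaCorank q = 0) :=
  ⟨fun p q _ _ ↦ transfer_W₁_of_thmE h1 hGZK p q, fun p q _ _ ↦ transfer_W₀_of_thmE h0 hGZK p q⟩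

/-! ## §4 CLASS-WIDE: T at every globally minimal model of an Eisenstein twist whose rank attains `ω₂(mn) ≤ 1` -/

section ClassWide

open Literature.NumberTheory.EllipticCurves.KubertTateEisensteinTwist

variable (m n : ℤ) [hEQ : (kubertTateFive (m : ℚ) (n : ℚ)).IsElliptic]
  (hcop : IsCoprime m n) (h5 : ¬ (5 : ℤ) ∣ (kubertTateFive m n).Δ)
  (hbad : ∀ ℓ : ℕ, ℓ.Prime → (ℓ : ℤ) ∣ (kubertTateFive m n).Δ → ℓ % 5 ≠ 1 ∧ (ℓ % 5 = 4 → ℓ % 3 = 1))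
  {x y : ℚ} (hxy : (kubertTateFive (m : ℚ) (n : ℚ)).toAffine.Nonsingular x y) (hx0 : x ≠ 0) (hx : x ≠ m * n)
  (q : ℕ) [Fact q.Prime] (hq5 : q ≠ 5) (hq11 : 2 * q + 1 < 25) (hqΔ : ¬ (q : ℤ) ∣ (kubertTateFive m n).Δ)
  (hr : (m * n).natAbs.primeFactors.card ≤ (kubertTateFive (m : ℚ) (n : ℚ)).mordellWeilRank + 1)
  [htw : ((kubertTateFive (m : ℚ) (n : ℚ)).quadraticTwist (-3)).IsElliptic]
  (hr' : ((m * n).natAbs.primeFactors.filter (fun ℓ ↦ ℓ % 3 = 1)).card ≤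
    ((kubertTateFive (m : ℚ) (n : ℚ)).quadraticTwist (-3)).mordellWeilRank)
  (hω : ((m * n).natAbs.primeFactors.filter (fun ℓ ↦ ℓ % 3 = 1)).card ≤ 1)
  (W' : WeierstrassCurve ℚ) [W'.IsElliptic] [W'.IsGloballyMinimal] (C : VariableChange ℚ)
  (hC : C • W' = (kubertTateFive (m : ℚ) (n : ℚ)).quadraticTwist (-3))

include hcop h5 hbad hxy hx0 hx hq5 hq11 hqΔ hr hr' hω hC in
/-- **CLASS-WIDE, modulo CGLS Thm. E + GZK: `ord_{s=1} L(W', s) = rank W'(ℚ) = ω₂(mn)` and `Ш(W'/ℚ)` is finite** for every globally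
minimal model `W'` of the Eisenstein twist `E_{m,n}^{(-3)}` of a coprime, Eisenstein-tame, full-box Kubert–Tate curve whose twist rank attains
`ω₂(mn) ≤ 1` (both printed cases `r ∈ {0, 1}` of Theorem E; its standing hypotheses and the Selmer corank are tree theorems,
`cgls_hypotheses_of_model`). [cite: CastellaGrossiLeeSkinner2022, Theorem E (r ∈ {0,1})] [cite: Darmon2004, Thm. 3.22] -/
theorem analyticRank_eq_and_finite_sha_of_eisensteinTwistModel_of_thmE
    (h1 : thmE_analyticRank_eq_one_of_selmerCorank_eq_one) (h0 : thmE_analyticRank_eq_zero_of_selmerCorank_eq_zero)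
    (hGZK : rank_eq_analyticRank_of_analyticRank_le_one) :
    W'.analyticRank = ((m * n).natAbs.primeFactors.filter (fun ℓ ↦ ℓ % 3 = 1)).card ∧
      W'.mordellWeilRank = ((m * n).natAbs.primeFactors.filter (fun ℓ ↦ ℓ % 3 = 1)).card ∧ Finite W'.sha := by
  haveI : Fact (Nat.Prime 5) := ⟨Nat.prime_five⟩
  obtain ⟨hgood, hred, hna, hsel, hrk⟩ :=
    cgls_hypotheses_of_model m n hcop h5 hbad hxy hx0 hx q hq5 hq11 hqΔ hr hr' W' C hC
  rcases Nat.le_one_iff_eq_zero_or_eq_one.mp hω with hω0 | hω1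
  · rw [hω0] at hsel hrk ⊢
    obtain ⟨ha, -, hfin⟩ := rank_eq_zero_and_finite_sha_of_thmE (p := 5) h0 hGZK (by norm_num) hgood hred hna hsel
    exact ⟨ha, hrk, hfin⟩
  · rw [hω1] at hsel hrk ⊢
    obtain ⟨ha, -, hfin⟩ := rank_eq_one_and_finite_sha_of_thmE (p := 5) h1 hGZK (by norm_num) hgood hred hna hsel
    exact ⟨ha, hrk, hfin⟩

include hcop h5 hbad hxy hx0 hx hq5 hq11 hqΔ hr hr' hω hC in
/-- **T DISCHARGED CLASS-WIDE AT THE EISENSTEIN TWISTS OF RANK `ω₂ ≤ 1`, MODULO REFEREED PRINT.** Granting CGLS Theorem E (`r ∈ {0,1}`)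
and Gross–Zagier–Kolyvagin, the instance of `FiniteShaComponentTransfer` holds at every globally minimal model `W'` of `E_{m,n}^{(-3)}` as in
`analyticRank_eq_and_finite_sha_of_eisensteinTwistModel_of_thmE` — indeed every `t_p(W') = 0`.  The per-curve certificate is decidable: a box of
rational points on `E_{m,n}` and, when `ω₂(mn) = 1`, one point of infinite order on the twist.  T itself (corank ≥ 2) is untouched.
[cite: CastellaGrossiLeeSkinner2022, Theorem E] [cite: Darmon2004, Thm. 3.22] -/
theorem transfer_of_eisensteinTwistModel_of_thmE
    (h1 : thmE_analyticRank_eq_one_of_selmerCorank_eq_one) (h0 : thmE_analyticRank_eq_zero_of_selmerCorank_eq_zero)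
    (hGZK : rank_eq_analyticRank_of_analyticRank_le_one) (p₁ p₂ : ℕ) [Fact p₁.Prime] [Fact p₂.Prime] :
    W'.shaCorank p₁ = 0 → W'.shaCorank p₂ = 0 := by
  intro _
  haveI := (analyticRank_eq_and_finite_sha_of_eisensteinTwistModel_of_thmE m n hcop h5 hbad hxy hx0 hx q hq5 hq11 hqΔ hr hr' hω
    W' C hC h1 h0 hGZK).2.2
  exact (finite_primaryComponent_sha_iff_shaCorank_eq_zero _ p₂).1 inferInstance

omit [W'.IsGloballyMinimal] in
include h5 hbad hxy hx0 hx hq5 hq11 hqΔ hr hr' hC in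
/-- **O for every model `W'` of such a twist, unconditionally** (door `p₀ = 5`: `t₅(W') = corank Sel₅∞ − rank = 0`).
[cite: SilvermanAEC2009, Thm. X.4.2] -/
theorem oneFiniteShaComponent_of_eisensteinTwistModel : ∃ (p : ℕ) (_ : Fact p.Prime), W'.shaCorank p = 0 := by
  haveI : Fact (Nat.Prime 5) := ⟨Nat.prime_five⟩
  refine ⟨5, inferInstance, ?_⟩
  obtain ⟨ht, -, -⟩ := twist_door_of_le_rank_three m n h5 hbad hxy hx0 hx q hq5 hq11 hqΔ hr hr'
  have hsel := selmerCorank_five_of_model m n W' C hC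
  have hrk := mordellWeilRank_of_model m n W' C hC
  have hG := W'.selmerCorank_eq_mordellWeilRank_add_holds 5
  omega

end ClassWide

/-! ## §5 (appended) BSD's RANK statement at the Eisenstein twists, modulo CGLS Thm. E ALONE (no GZK)

Placement note for §§1–4: the CONDITIONAL schema «rank `E(ℚ) ∈ {0,1}`, `t_p(E) = 0` at a non-anomalous Eisenstein prime `p` of good
reduction ⟹ every `t_q(E) = 0`, modulo CGLS Thm. E + GZK» is the g3 census row of this seat
(`ShaPrimaryTransferDoorEisensteinSS.transfer_doorEisenstein_rank_zero/_one`, inputs `hgood hred hna hr h0` as HYPOTHESES); the files of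
this generation SUPPLY those inputs as tree theorems — class-wide for the Eisenstein twists `E_{m,n}^{(-3)}` of rank `ω₂(mn) ≤ 1`
(descent over `ℚ(ζ₃)` for `hr`, `h0`; the twisting formula for `hna`) and numerically for `W₀`, `W₁`, `W₂`.  "First" in the header of this
file is meant in that sense: the first curves without rational `5`-torsion at which the schema's inputs are theorems of the tree. -/

section RankStatement

open Literature.NumberTheory.EllipticCurves.KubertTateEisensteinTwist

variable (m n : ℤ) [hEQ : (kubertTateFive (m : ℚ) (n : ℚ)).IsElliptic]
  (hcop : IsCoprime m n) (h5 : ¬ (5 : ℤ) ∣ (kubertTateFive m n).Δ)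
  (hbad : ∀ ℓ : ℕ, ℓ.Prime → (ℓ : ℤ) ∣ (kubertTateFive m n).Δ → ℓ % 5 ≠ 1 ∧ (ℓ % 5 = 4 → ℓ % 3 = 1))
  {x y : ℚ} (hxy : (kubertTateFive (m : ℚ) (n : ℚ)).toAffine.Nonsingular x y) (hx0 : x ≠ 0) (hx : x ≠ m * n)
  (q : ℕ) [Fact q.Prime] (hq5 : q ≠ 5) (hq11 : 2 * q + 1 < 25) (hqΔ : ¬ (q : ℤ) ∣ (kubertTateFive m n).Δ)
  (hr : (m * n).natAbs.primeFactors.card ≤ (kubertTateFive (m : ℚ) (n : ℚ)).mordellWeilRank + 1)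
  [htw : ((kubertTateFive (m : ℚ) (n : ℚ)).quadraticTwist (-3)).IsElliptic]
  (hr' : ((m * n).natAbs.primeFactors.filter (fun ℓ ↦ ℓ % 3 = 1)).card ≤
    ((kubertTateFive (m : ℚ) (n : ℚ)).quadraticTwist (-3)).mordellWeilRank)
  (hω : ((m * n).natAbs.primeFactors.filter (fun ℓ ↦ ℓ % 3 = 1)).card ≤ 1)
  (W' : WeierstrassCurve ℚ) [W'.IsElliptic] [W'.IsGloballyMinimal] (C : VariableChange ℚ)
  (hC : C • W' = (kubertTateFive (m : ℚ) (n : ℚ)).quadraticTwist (-3))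

include hcop h5 hbad hxy hx0 hx hq5 hq11 hqΔ hr hr' hω hC in
/-- **BSD's RANK statement `ord_{s=1} L(W', s) = rank W'(ℚ)` at every globally minimal model of an Eisenstein twist of rank `ω₂ ≤ 1`, MODULO
CGLS Thm. E ALONE** (class-wide; no Gross–Zagier–Kolyvagin needed: the algebraic side `rank W' = ω₂(mn)` is a tree theorem by descent, the
analytic side `ord_{s=1} L(W', s) = corank Sel₅∞ = ω₂(mn)` is Theorem E at the non-anomalous Eisenstein prime `5`).  This is the summit
statement's shape at `W'`, conditional on one refereed named fact. [cite: CastellaGrossiLeeSkinner2022, Theorem E (r ∈ {0,1})] -/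
theorem analyticRank_eq_mordellWeilRank_of_eisensteinTwistModel_of_thmE
    (h1 : thmE_analyticRank_eq_one_of_selmerCorank_eq_one) (h0 : thmE_analyticRank_eq_zero_of_selmerCorank_eq_zero) :
    W'.analyticRank = W'.mordellWeilRank := by
  haveI : Fact (Nat.Prime 5) := ⟨Nat.prime_five⟩
  obtain ⟨hgood, hred, hna, hsel, hrk⟩ :=
    cgls_hypotheses_of_model m n hcop h5 hbad hxy hx0 hx q hq5 hq11 hqΔ hr hr' W' C hC
  rcases Nat.le_one_iff_eq_zero_or_eq_one.mp hω with hω0 | hω1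
  · rw [hω0] at hsel hrk
    rw [hrk, h0 _ 5 (by norm_num) hgood hred hna hsel]
  · rw [hω1] at hsel hrk
    rw [hrk, h1 _ 5 (by norm_num) hgood hred hna hsel]

end RankStatement

/-- **BSD's rank statement at the rows `W₀` (rank `0`) and `W₁` (rank `1`), modulo CGLS Thm. E alone**:
`ord_{s=1} L(W₀, s) = 0 = rank W₀(ℚ)` and `ord_{s=1} L(W₁, s) = 1 = rank W₁(ℚ)` (tree: `KubertTateM223EisensteinTwist.mordellWeilRank_model`,
`KubertTate373EisensteinTwist.mordellWeilRank_model`). [cite: CastellaGrossiLeeSkinner2022, Theorem E (r ∈ {0,1})] -/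
theorem analyticRank_eq_mordellWeilRank_W₀_W₁_of_thmE
    (h1 : thmE_analyticRank_eq_one_of_selmerCorank_eq_one) (h0 : thmE_analyticRank_eq_zero_of_selmerCorank_eq_zero) :
    haveI := KubertTateM223EisensteinTwist.isElliptic_model
    haveI := KubertTate373EisensteinTwist.isElliptic_model
    (⟨((1 : ℤ) : ℚ), ((-613 : ℤ) : ℚ), ((-12 : ℤ) : ℚ), ((121470 : ℤ) : ℚ), ((-7796228 : ℤ) : ℚ)⟩ : WeierstrassCurve ℚ).analyticRank =
        (⟨((1 : ℤ) : ℚ), ((-613 : ℤ) : ℚ), ((-12 : ℤ) : ℚ), ((121470 : ℤ) : ℚ), ((-7796228 : ℤ) : ℚ)⟩ : WeierstrassCurve ℚ).mordellWeilRank ∧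
      (⟨((0 : ℤ) : ℚ), ((-540 : ℤ) : ℚ), ((-11 : ℤ) : ℚ), ((53097 : ℤ) : ℚ), ((-852573 : ℤ) : ℚ)⟩ : WeierstrassCurve ℚ).analyticRank =
        (⟨((0 : ℤ) : ℚ), ((-540 : ℤ) : ℚ), ((-11 : ℤ) : ℚ), ((53097 : ℤ) : ℚ), ((-852573 : ℤ) : ℚ)⟩ : WeierstrassCurve ℚ).mordellWeilRank := by
  haveI := KubertTateM223EisensteinTwist.isElliptic_model
  haveI := KubertTate373EisensteinTwist.isElliptic_model
  constructor
  · rw [analyticRank_W₀_eq_zero_of_thmE h0, KubertTateM223EisensteinTwist.mordellWeilRank_model]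
  · rw [analyticRank_W₁_eq_one_of_thmE h1, KubertTate373EisensteinTwist.mordellWeilRank_model]

end Summit.BirchSwinnertonDyer.BirchSwinnertonDyer.Theorems.ShaPrimaryTransferEisensteinTwistDoor

end
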